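import Summits.RiemannHypothesis.RiemannHypothesis.Theses.SpectralTrace
import Summits.RiemannHypothesis.RiemannHypothesis.Theorems.WindowTraceArch.Negative.LocalWeylTools
import Literature.NumberTheory.LFunctions.WeilArchimedeanPositivityProofs
import HarnessLib

/-!
# `WindowStep` — negative lemma: nested window families coincide

Refuter (crux disprover) record for the crux `stmt-RiemannHypothesis-14659`
(`Summit.RiemannHypothesis.RiemannHypothesis.Theses.SpectralTrace.WindowStep`, the collar-healing
step `Trace(log n) → Trace(log (n+1))` of route SpectralTrace). The crux text proposes to heal the
collar defect by "moving/adding atoms (real positions, unit masses)". This file closes the two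
one-sided options unconditionally:

* `surjective_of_subfamily_windowTrace` (**core**): if a real family `γ' : ι' → ℝ` reproduces the
  Weil functional on the Weil tests supported in `[-A, A]` (`A > 0`) and so does a SUB-family
  `γ' ∘ e` (`e : ι → ι'` injective), then `e` is onto — the two families are the same multiset.
  Proof: the complementary atoms `j ∉ range e` contribute `0` to every test on the window; test
  with the modulated autocorrelation `w_T ⋆ w̃_T` of a narrow bump centred at a complementary atom
  `T = γ'_{j₀}` (`exists_bump_lower`, `weilMellin_modulate`, `weilMellin_weilConv_weilReflect_half`
  — all in tree): the complementary costs `|ŵ(γ'_j - T)|² ≥ 0` sum to `0`, yet the cost at `j₀`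
  is `|ŵ(0)|² ≥ c > 0`.
* `windowTrace_of_extension` / `no_windowStep_by_extension`: a rung family obtained from a
  rung-`A` family by ADDING atoms only (any number, any heights) is a rung-`B` family (`A ≤ B`)
  only if nothing was added and the old family already was one;
* `windowTrace_of_restriction` / `no_windowStep_by_deletion`: the same for DELETING atoms only.

Consequence for the step `n → n+1` (`A = log n`, `B = log (n+1)`): whenever the rung-`n` family
is not already a rung-`(n+1)` family, every healing both removes (moves away) some atoms and adds
(moves in) some atoms; with `FiniteMoves.lean` (companion file) infinitely many of them, reaching
unbounded heights. No arithmetic enters: the statements hold for every window `A > 0`.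
-/

set_option linter.dupNamespace false

noncomputable section

open Complex Set Filter
open scoped Real Topology

namespace Summit.RiemannHypothesis.RiemannHypothesis.Theorems.WindowStep.Negative

open Literature.NumberTheory.LFunctions
open Summit.RiemannHypothesis.RiemannHypothesis.Theses.SpectralTrace
open Summit.RiemannHypothesis.RiemannHypothesis.Theorems.WindowTraceArch.Negative

/-- A family reproducing `W` on the tests supported in `[-B, B]` reproduces it on the tests
supported in `[-A, A]`, `A ≤ B` (family-level antitonicity). [folklore] -/
theorem windowTraceFamily_anti {A B : ℝ} (hAB : A ≤ B) {ι : Type*} {γ : ι → ℝ}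
    (h : ∀ g : ℝ → ℂ, IsWeilTest g → tsupport g ⊆ Icc (-B) B →
      HasSum (fun i => weilMellin g (1 / 2 + (γ i : ℂ) * I)) (weilFunctional g)) :
    ∀ g : ℝ → ℂ, IsWeilTest g → tsupport g ⊆ Icc (-A) A →
      HasSum (fun i => weilMellin g (1 / 2 + (γ i : ℂ) * I)) (weilFunctional g) :=
  fun g hg hgs => h g hg (hgs.trans (Icc_subset_Icc (neg_le_neg hAB) hAB))

/-- **Core: nested window families coincide.** If `γ' : ι' → ℝ` reproduces the Weil functional
on the Weil tests supported in `[-A, A]` (`A > 0`) and the sub-family `γ' ∘ e` (`e` injective)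
does too, then `e` is surjective: no atom of `γ'` is left over. [folklore] -/
theorem surjective_of_subfamily_windowTrace {A : ℝ} (hA : 0 < A) {ι ι' : Type*} {γ' : ι' → ℝ}
    {e : ι → ι'} (he : Function.Injective e)
    (h' : ∀ g : ℝ → ℂ, IsWeilTest g → tsupport g ⊆ Icc (-A) A →
      HasSum (fun j => weilMellin g (1 / 2 + (γ' j : ℂ) * I)) (weilFunctional g))
    (h : ∀ g : ℝ → ℂ, IsWeilTest g → tsupport g ⊆ Icc (-A) A →
      HasSum (fun i => weilMellin g (1 / 2 + (γ' (e i) : ℂ) * I)) (weilFunctional g)) :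
    Function.Surjective e := by
  by_contra hsurj
  obtain ⟨j₀, hj₀'⟩ := not_forall.1 hsurj
  have hj₀ : j₀ ∉ Set.range e := fun ⟨i, hi⟩ => hj₀' ⟨i, hi⟩
  -- a narrow bump `w`, `supp w ⊆ [-δ, δ]`, `δ ≤ A/2`, with `|ŵ(1/2+iv)|² ≥ c > 0` on `|v| ≤ 1`
  set δ : ℝ := min (A / 2) (1 / 2) with hδ_def
  have hδ : 0 < δ := lt_min (half_pos hA) one_half_pos
  have hδA : δ ≤ A / 2 := min_le_left _ _
  have hδ1 : δ ≤ 1 / 2 := min_le_right _ _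
  obtain ⟨w, hw, hws, -, c, hc, hlow⟩ := exists_bump_lower hδ hδ1
  -- modulate it to the left-over atom `T = γ' j₀` and take the autocorrelation
  set T : ℝ := γ' j₀ with hT
  set wT : ℝ → ℂ := fun t => cexp (-((T * t : ℝ) : ℂ) * I) * w t with hwT_def
  have hwT : IsWeilTest wT := isWeilTest_modulate hw T
  have hwTs : tsupport wT ⊆ Icc (-(A / 2)) (A / 2) :=
    ((tsupport_modulate_subset w T).trans hws).trans (Icc_subset_Icc (by linarith) hδA)
  set k : ℝ → ℂ := weilConv wT (weilReflect wT) with hk_def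
  have hk : IsWeilTest k := hwT.weilConv hwT.weilReflect
  have hks : tsupport k ⊆ Icc (-A) A :=
    (tsupport_weilConv_weilReflect_subset hwT.2 hwTs).trans
      (Icc_subset_Icc (by linarith) (by linarith))
  -- costs of the atoms against `k`
  set f : ι' → ℂ := fun j => weilMellin k (1 / 2 + (γ' j : ℂ) * I) with hf_def
  have hf' : HasSum f (weilFunctional k) := h' k hk hks
  have hf : HasSum (f ∘ e) (weilFunctional k) := h k hk hks
  -- the atoms outside `range e` contribute `0`
  have hfr : HasSum (f ∘ (↑) : Set.range e → ℂ) (weilFunctional k) :=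
    he.hasSum_range_iff.2 hf
  have hsc : Summable (f ∘ (↑) : ((Set.range e)ᶜ : Set ι') → ℂ) := hf'.summable.subtype _
  have h0 : ∑' j : ((Set.range e)ᶜ : Set ι'), f j = 0 := by
    have h2 := (hfr.add_compl hsc.hasSum).unique hf'
    simpa using h2
  have hcompl : HasSum (f ∘ (↑) : ((Set.range e)ᶜ : Set ι') → ℂ) 0 := h0 ▸ hsc.hasSum
  -- these contributions are the non-negative reals `|ŵ_T(1/2 + iγ'_j)|²`
  have hreal : ∀ j, f j = ((‖weilMellin wT (1 / 2 + (γ' j : ℂ) * I)‖ ^ 2 : ℝ) : ℂ) := fun j =>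
    weilMellin_weilConv_weilReflect_half hwT (γ' j)
  have hR : HasSum (fun j : ((Set.range e)ᶜ : Set ι') =>
      ‖weilMellin wT (1 / 2 + (γ' j : ℂ) * I)‖ ^ 2) 0 := by
    have h3 := hcompl.mapL Complex.reCLM
    simpa only [Function.comp_def, hreal, Complex.reCLM_apply, Complex.ofReal_re, map_zero]
      using h3
  have hzero := (hasSum_zero_iff_of_nonneg (fun j => by positivity)).1 hR
  have hj : ‖weilMellin wT (1 / 2 + (γ' j₀ : ℂ) * I)‖ ^ 2 = 0 := by
    have h4 := congr_fun hzero ⟨j₀, hj₀⟩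
    simpa using h4
  -- but the left-over atom itself costs at least `c > 0`
  have hlow0 : c ≤ ‖weilMellin wT (1 / 2 + (γ' j₀ : ℂ) * I)‖ ^ 2 := by
    have e1 : weilMellin wT (1 / 2 + (γ' j₀ : ℂ) * I) =
        weilMellin w (1 / 2 + ((γ' j₀ - T : ℝ) : ℂ) * I) := weilMellin_modulate w T (γ' j₀)
    rw [e1]
    refine hlow (γ' j₀ - T) ?_
    rw [hT, sub_self, abs_zero]
    exact zero_le_one
  linarith

/-- Nested window families: under the hypotheses of `surjective_of_subfamily_windowTrace` the
embedding is a bijection (a re-indexing of one and the same multiset). [folklore] -/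
theorem bijective_of_subfamily_windowTrace {A : ℝ} (hA : 0 < A) {ι ι' : Type*} {γ' : ι' → ℝ}
    {e : ι → ι'} (he : Function.Injective e)
    (h' : ∀ g : ℝ → ℂ, IsWeilTest g → tsupport g ⊆ Icc (-A) A →
      HasSum (fun j => weilMellin g (1 / 2 + (γ' j : ℂ) * I)) (weilFunctional g))
    (h : ∀ g : ℝ → ℂ, IsWeilTest g → tsupport g ⊆ Icc (-A) A →
      HasSum (fun i => weilMellin g (1 / 2 + (γ' (e i) : ℂ) * I)) (weilFunctional g)) :
    Function.Bijective e :=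
  ⟨he, surjective_of_subfamily_windowTrace hA he h' h⟩

/-- **No step by pure addition of atoms.** If `γ' ∘ e` (`e` injective) reproduces `W` on the
tests supported in `[-A, A]` (`0 < A ≤ B`) and the extended family `γ'` reproduces `W` on the
tests supported in `[-B, B]`, then nothing was added (`e` is a bijection) and the old family
`γ' ∘ e` already reproduces `W` on `[-B, B]`. [folklore] -/
theorem windowTrace_of_extension {A B : ℝ} (hA : 0 < A) (hAB : A ≤ B) {ι ι' : Type*}
    {γ' : ι' → ℝ} {e : ι → ι'} (he : Function.Injective e)
    (hB : ∀ g : ℝ → ℂ, IsWeilTest g → tsupport g ⊆ Icc (-B) B →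
      HasSum (fun j => weilMellin g (1 / 2 + (γ' j : ℂ) * I)) (weilFunctional g))
    (hAsub : ∀ g : ℝ → ℂ, IsWeilTest g → tsupport g ⊆ Icc (-A) A →
      HasSum (fun i => weilMellin g (1 / 2 + (γ' (e i) : ℂ) * I)) (weilFunctional g)) :
    Function.Bijective e ∧
      ∀ g : ℝ → ℂ, IsWeilTest g → tsupport g ⊆ Icc (-B) B →
        HasSum (fun i => weilMellin g (1 / 2 + (γ' (e i) : ℂ) * I)) (weilFunctional g) := by
  have hbij : Function.Bijective e :=
    bijective_of_subfamily_windowTrace hA he (windowTraceFamily_anti hAB hB) hAsub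
  refine ⟨hbij, fun g hg hgs => ?_⟩
  exact (Equiv.ofBijective e hbij).hasSum_iff.2 (hB g hg hgs)

/-- **No step by pure deletion of atoms.** If `γ : ι → ℝ` reproduces `W` on the tests supported
in `[-A, A]` (`0 < A ≤ B`) and a sub-family `γ|_S` reproduces `W` on the tests supported in
`[-B, B]`, then nothing was deleted (`S = univ`) and `γ` itself reproduces `W` on `[-B, B]`.
[folklore] -/
theorem windowTrace_of_restriction {A B : ℝ} (hA : 0 < A) (hAB : A ≤ B) {ι : Type*}
    {γ : ι → ℝ} (S : Set ι)
    (hAγ : ∀ g : ℝ → ℂ, IsWeilTest g → tsupport g ⊆ Icc (-A) A →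
      HasSum (fun i => weilMellin g (1 / 2 + (γ i : ℂ) * I)) (weilFunctional g))
    (hBS : ∀ g : ℝ → ℂ, IsWeilTest g → tsupport g ⊆ Icc (-B) B →
      HasSum (fun i : S => weilMellin g (1 / 2 + (γ i : ℂ) * I)) (weilFunctional g)) :
    S = Set.univ ∧
      ∀ g : ℝ → ℂ, IsWeilTest g → tsupport g ⊆ Icc (-B) B →
        HasSum (fun i => weilMellin g (1 / 2 + (γ i : ℂ) * I)) (weilFunctional g) := by
  have hbij : Function.Bijective (Subtype.val : S → ι) :=
    bijective_of_subfamily_windowTrace (γ' := γ) hA Subtype.val_injective hAγ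
      (windowTraceFamily_anti hAB hBS)
  refine ⟨?_, fun g hg hgs => ?_⟩
  · ext i
    simp only [Set.mem_univ, iff_true]
    obtain ⟨⟨i', hi'⟩, rfl⟩ := hbij.2 i
    exact hi'
  · exact (Equiv.ofBijective _ hbij).hasSum_iff.1 (hBS g hg hgs)

/-- **Crux form (addition).** Take a rung-`A` family `γ` that is not a rung-`B` family
(`0 < A ≤ B`; for the step, `A = log n`, `B = log (n+1)`). Then NO family obtained from `γ` by
adding atoms (an injection `e` with `γ' ∘ e = γ`) is a rung-`B` family. [folklore] -/
theorem no_windowStep_by_extension {A B : ℝ} (hA : 0 < A) (hAB : A ≤ B) {ι ι' : Type*}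
    {γ : ι → ℝ} {γ' : ι' → ℝ} {e : ι → ι'} (he : Function.Injective e)
    (hext : ∀ i, γ' (e i) = γ i)
    (hAγ : ∀ g : ℝ → ℂ, IsWeilTest g → tsupport g ⊆ Icc (-A) A →
      HasSum (fun i => weilMellin g (1 / 2 + (γ i : ℂ) * I)) (weilFunctional g))
    (hBγ : ¬ ∀ g : ℝ → ℂ, IsWeilTest g → tsupport g ⊆ Icc (-B) B →
      HasSum (fun i => weilMellin g (1 / 2 + (γ i : ℂ) * I)) (weilFunctional g)) :
    ¬ ∀ g : ℝ → ℂ, IsWeilTest g → tsupport g ⊆ Icc (-B) B →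
      HasSum (fun j => weilMellin g (1 / 2 + (γ' j : ℂ) * I)) (weilFunctional g) := by
  intro hB
  have hAsub : ∀ g : ℝ → ℂ, IsWeilTest g → tsupport g ⊆ Icc (-A) A →
      HasSum (fun i => weilMellin g (1 / 2 + (γ' (e i) : ℂ) * I)) (weilFunctional g) := by
    simpa only [hext] using hAγ
  have h2 := (windowTrace_of_extension hA hAB he hB hAsub).2
  simp only [hext] at h2
  exact hBγ h2

/-- **Crux form (deletion).** Take a rung-`A` family `γ` that is not a rung-`B` family
(`0 < A ≤ B`). Then NO sub-family of `γ` is a rung-`B` family. [folklore] -/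
theorem no_windowStep_by_deletion {A B : ℝ} (hA : 0 < A) (hAB : A ≤ B) {ι : Type*}
    {γ : ι → ℝ} (S : Set ι)
    (hAγ : ∀ g : ℝ → ℂ, IsWeilTest g → tsupport g ⊆ Icc (-A) A →
      HasSum (fun i => weilMellin g (1 / 2 + (γ i : ℂ) * I)) (weilFunctional g))
    (hBγ : ¬ ∀ g : ℝ → ℂ, IsWeilTest g → tsupport g ⊆ Icc (-B) B →
      HasSum (fun i => weilMellin g (1 / 2 + (γ i : ℂ) * I)) (weilFunctional g)) :
    ¬ ∀ g : ℝ → ℂ, IsWeilTest g → tsupport g ⊆ Icc (-B) B →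
      HasSum (fun i : S => weilMellin g (1 / 2 + (γ i : ℂ) * I)) (weilFunctional g) :=
  fun hBS => hBγ (windowTrace_of_restriction hA hAB S hAγ hBS).2

/-- The step instance: for `2 ≤ n`, `0 < log n ≤ log (n + 1)`, so the four theorems above apply
verbatim to `A = log n`, `B = log (n+1)` (the windows of `WindowStep`). [folklore] -/
theorem log_rung_pos_and_le {n : ℕ} (hn : 2 ≤ n) :
    0 < Real.log (n : ℝ) ∧ Real.log (n : ℝ) ≤ Real.log ((n : ℝ) + 1) := by
  have h2 : (2 : ℝ) ≤ (n : ℝ) := by exact_mod_cast hn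
  exact ⟨Real.log_pos (by linarith), Real.log_le_log (by linarith) (by linarith)⟩

end Summit.RiemannHypothesis.RiemannHypothesis.Theorems.WindowStep.Negative

end
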